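import Literature.Analysis.SpecialFunctions.HypergeometricPolynomial
import Mathlib.Analysis.SpecialFunctions.Integrability.Basic
import Mathlib.Analysis.SpecialFunctions.Pow.Deriv
import Mathlib.MeasureTheory.Integral.IntervalIntegral.FundThmCalculus
import HarnessLib

/-!
# Orthogonality of the hypergeometric polynomials `₂F₁(-n, n+1; c; z)` on `(0, 1)`

Topic `Literature/Analysis/SpecialFunctions` (generic; no percolation content). Real analysis,
sequel of `HypergeometricPolynomial.lean`; motivation and first use: the analytic half of the
discharge of `Literature.Probability.Percolation.LawlerSchrammWerner2002_hittingPDE` (LSW (2002),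
Lemma 2.2).
For `1 < c < 2` (for LSW, `c = 3/2 - 2/κ` with `κ > 4`) the hypergeometric operator
`z(1-z) ∂² + (c - 2z) ∂` of Euler's equation (AAR (2.3.5), `a + b = 1`) is symmetric with respect
to the Jacobi weight

  `ρ(z) = z^{c-1} (1-z)^{1-c}`  on `(0, 1)`,   `ρ · [z(1-z) y'' + (c-2z) y'] = (P y')'`,
  `P(z) = z^c (1-z)^{2-c}`,  `P(0) = P(1) = 0`,

so the polynomials `y_n = hypJacobi c n` (eigenvalues `-n(n+1)`) are orthogonal in
`L²((0,1), ρ dz)` — AAR (2.5.14) for the Jacobi polynomials `P_n^{(c-1,1-c)}(1-2z)` — and satisfy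
the energy identity `∫ P (y_n')² = n(n+1) ∫ ρ y_n²`. Everything is PROVED (Green's identity by the
fundamental theorem of calculus on `[0, 1]` for `F = P y' r`, which is continuous on `[0, 1]`,
vanishes at both ends and is differentiable inside; the weight is integrable since `1 - c > -1`).
Pulled back by `z = sin²(θ/4)` this is the symmetry of LSW's `Λ = (κ/2)∂² + cot(θ/2)∂` in
`L²((0, 2π), sin(θ/2)^{4/κ} dθ)` restricted to the Dirichlet-at-`0` branch
(`Literature/Probability/Percolation/OneArmEigenfunctions.lean`).
No named fact is introduced.

## Contents

* `jacobiWeight c` (`ρ`), `jacobiFlux c` (`P`): positivity, `P = ρ · z(1-z)` on `[0, 1]`,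
  continuity of `P`, `P(0) = P(1) = 0`, `hasDerivAt_jacobiFlux` (`P' = ρ (c - 2z)`),
  `intervalIntegrable_jacobiWeight`;
* `jacobi_green` — `∫₀¹ ρ [z(1-z) p'' + (c-2z) p'] r = -∫₀¹ P p' r'` for polynomials `p, r`;
* `integral_jacobiWeight_hypJacobi_mul_hypJacobi` — **orthogonality** (`n ≠ m`);
  `integral_jacobiFlux_derivative_sq` — **energy identity**;
  `integral_jacobiWeight_hypJacobi_sq_pos` — `0 < ∫₀¹ ρ y_n²`;
* `hypJacobiCoeff_ne_zero`, `natDegree_hypJacobi` — `deg y_n = n` exactly.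

## References

* G. E. Andrews, R. Askey, R. Roy, *Special Functions*, CUP (1999): (2.3.5), Def. 2.5.1,
  (2.5.14). [AndrewsAskeyRoy1999]
* G. F. Lawler, O. Schramm, W. Werner, *One-arm exponent for critical 2D percolation*, Electron.
  J. Probab. 7 (2002), no. 2, §2, Lemma 2.2. [LawlerSchrammWernerEJP2002]
-/

noncomputable section

open Polynomial Set MeasureTheory intervalIntegral
open scoped Topology

namespace Literature.Analysis.SpecialFunctions

/-! ### The weight `ρ` and the flux coefficient `P` -/

/-- The Jacobi weight `ρ(z) = z^{c-1} (1-z)^{1-c}` on `(0, 1)` (the weight `(1-x)^α (1+x)^β`,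
`α = c - 1`, `β = 1 - c`, of AAR (2.5.14) in the variable `x = 1 - 2z`, up to a constant).
[cite: AndrewsAskeyRoy1999, (2.5.14)] -/
def jacobiWeight (c z : ℝ) : ℝ := z ^ (c - 1) * (1 - z) ^ (1 - c)

/-- The flux coefficient `P(z) = z^c (1-z)^{2-c} = ρ(z) z (1-z)` of the self-adjoint form
`(P y')' = ρ [z(1-z) y'' + (c - 2z) y']` of Euler's hypergeometric operator with `a + b = 1`.
[folklore] -/
def jacobiFlux (c z : ℝ) : ℝ := z ^ c * (1 - z) ^ (2 - c)

section Weight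

variable {c : ℝ}

/-- `ρ > 0` on `(0, 1)`. [folklore] -/
theorem jacobiWeight_pos (c : ℝ) {z : ℝ} (hz : z ∈ Ioo 0 1) : 0 < jacobiWeight c z :=
  mul_pos (Real.rpow_pos_of_pos hz.1 _) (Real.rpow_pos_of_pos (by linarith [hz.2]) _)

/-- `ρ ≥ 0` on `[0, 1]`. [folklore] -/
theorem jacobiWeight_nonneg (c : ℝ) {z : ℝ} (hz : z ∈ Icc 0 1) : 0 ≤ jacobiWeight c z :=
  mul_nonneg (Real.rpow_nonneg hz.1 _) (Real.rpow_nonneg (by linarith [hz.2]) _)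

/-- `P ≥ 0` on `[0, 1]`. [folklore] -/
theorem jacobiFlux_nonneg (c : ℝ) {z : ℝ} (hz : z ∈ Icc 0 1) : 0 ≤ jacobiFlux c z :=
  mul_nonneg (Real.rpow_nonneg hz.1 _) (Real.rpow_nonneg (by linarith [hz.2]) _)

/-- `P > 0` on `(0, 1)`. [folklore] -/
theorem jacobiFlux_pos (c : ℝ) {z : ℝ} (hz : z ∈ Ioo 0 1) : 0 < jacobiFlux c z :=
  mul_pos (Real.rpow_pos_of_pos hz.1 _) (Real.rpow_pos_of_pos (by linarith [hz.2]) _)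

/-- `P(0) = 0` (`c ≠ 0`). [folklore] -/
theorem jacobiFlux_zero (hc : c ≠ 0) : jacobiFlux c 0 = 0 := by
  rw [jacobiFlux, Real.zero_rpow hc, zero_mul]

/-- `P(1) = 0` (`c ≠ 2`). [folklore] -/
theorem jacobiFlux_one (hc : c ≠ 2) : jacobiFlux c 1 = 0 := by
  rw [jacobiFlux, sub_self, Real.zero_rpow (by intro h; apply hc; linarith), mul_zero]

/-- `P = ρ · z (1 - z)` on the closed interval `[0, 1]` (both sides vanish at the endpoints when
`1 < c < 2`). [folklore] -/
theorem jacobiFlux_eq (hc : 1 < c) (hc2 : c < 2) {z : ℝ} (hz : z ∈ Icc 0 1) :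
    jacobiFlux c z = jacobiWeight c z * (z * (1 - z)) := by
  rcases hz.1.eq_or_lt with h0 | h0
  · subst h0
    rw [jacobiFlux_zero (by linarith), zero_mul, mul_zero]
  rcases hz.2.lt_or_eq with h1 | h1
  · rw [jacobiFlux, jacobiWeight, show c = (c - 1) + 1 by ring, Real.rpow_add_one h0.ne',
      show (2 : ℝ) - (c - 1 + 1) = (1 - c) + 1 by ring, show (1 : ℝ) - (c - 1 + 1) = 1 - c by ring,
      Real.rpow_add_one (by linarith : (1 : ℝ) - z ≠ 0)]
    ring
  · subst h1
    rw [jacobiFlux_one (by linarith), sub_self, mul_zero, mul_zero]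

/-- `P` is continuous on `ℝ` (`0 < c < 2`). [folklore] -/
theorem continuous_jacobiFlux (hc : 0 < c) (hc2 : c < 2) : Continuous (jacobiFlux c) :=
  (Real.continuous_rpow_const hc.le).mul
    ((continuous_const.sub continuous_id).rpow_const fun _ => Or.inr (by linarith))

/-- **`P' = ρ · (c - 2z)` on `(0, 1)`**. [folklore] -/
theorem hasDerivAt_jacobiFlux (c : ℝ) {z : ℝ} (hz : z ∈ Ioo 0 1) :
    HasDerivAt (jacobiFlux c) (jacobiWeight c z * (c - 2 * z)) z := by
  have h0 : z ≠ 0 := hz.1.ne'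
  have h1 : (1 : ℝ) - z ≠ 0 := by linarith [hz.2]
  have hA := Real.hasDerivAt_rpow_const (p := c) (Or.inl h0)
  have hB : HasDerivAt (fun y : ℝ => (1 - y) ^ (2 - c)) ((0 - 1) * (2 - c) * (1 - z) ^ (2 - c - 1))
      z :=
    ((hasDerivAt_const z (1 : ℝ)).sub (hasDerivAt_id z)).rpow_const (Or.inl h1)
  have hzc : z ^ c = z ^ (c - 1) * z := by rw [← Real.rpow_add_one h0, sub_add_cancel]
  have h1c : (1 - z) ^ (2 - c) = (1 - z) ^ (1 - c) * (1 - z) := by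
    rw [← Real.rpow_add_one h1, show (1 : ℝ) - c + 1 = 2 - c by ring]
  have h1c' : (1 - z) ^ (2 - c - 1) = (1 - z) ^ (1 - c) := by
    rw [show (2 : ℝ) - c - 1 = 1 - c by ring]
  refine (hA.mul hB).congr_deriv ?_
  rw [jacobiWeight, h1c', hzc, h1c]
  ring

/-- `z ↦ (1 - z)^{1-c}` is integrable on `[0, 1]` for `c < 2` (exponent `> -1`). [folklore] -/
theorem intervalIntegrable_one_sub_rpow (hc2 : c < 2) :
    IntervalIntegrable (fun z : ℝ => (1 - z) ^ (1 - c)) volume 0 1 := by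
  have h := (intervalIntegral.intervalIntegrable_rpow' (a := 1) (b := 0) (r := 1 - c)
    (by linarith)).comp_sub_left 1
  simpa using h

/-- **The weight is integrable on `[0, 1]`** (`1 ≤ c < 2`). [folklore] -/
theorem intervalIntegrable_jacobiWeight (hc : 1 ≤ c) (hc2 : c < 2) :
    IntervalIntegrable (jacobiWeight c) volume 0 1 := by
  have h := (intervalIntegrable_one_sub_rpow hc2).continuousOn_mul
    (g := fun z : ℝ => z ^ (c - 1)) (Real.continuous_rpow_const (by linarith)).continuousOn
  exact h

/-- `ρ · g` is integrable on `[0, 1]` for continuous `g` (`1 ≤ c < 2`). [folklore] -/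
theorem intervalIntegrable_jacobiWeight_mul (hc : 1 ≤ c) (hc2 : c < 2) {g : ℝ → ℝ}
    (hg : Continuous g) : IntervalIntegrable (fun z => jacobiWeight c z * g z) volume 0 1 :=
  (intervalIntegrable_jacobiWeight hc hc2).mul_continuousOn hg.continuousOn

end Weight

/-! ### Green's identity and orthogonality -/

section Green

variable {c : ℝ}

/-- **Green's identity** for the hypergeometric operator with `a + b = 1`: for polynomials
`p, r` and `1 < c < 2`,
`∫₀¹ ρ(z) [z(1-z) p''(z) + (c - 2z) p'(z)] r(z) dz = -∫₀¹ P(z) p'(z) r'(z) dz`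
(fundamental theorem of calculus for `F = P p' r`, `F(0) = F(1) = 0`). [folklore] -/
theorem jacobi_green (hc : 1 < c) (hc2 : c < 2) (p r : ℝ[X]) :
    ∫ z in (0 : ℝ)..1, jacobiWeight c z * ((z * (1 - z) * (derivative (derivative p)).eval z
        + (c - 2 * z) * (derivative p).eval z) * r.eval z)
      = -∫ z in (0 : ℝ)..1, jacobiFlux c z * (derivative p).eval z * (derivative r).eval z := by
  have hPc := continuous_jacobiFlux (by linarith : 0 < c) hc2
  have hp' := (Polynomial.differentiable (𝕜 := ℝ) (derivative p)).continuous
  have hp'' := (Polynomial.differentiable (𝕜 := ℝ) (derivative (derivative p))).continuous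
  have hr := (Polynomial.differentiable (𝕜 := ℝ) r).continuous
  have hr' := (Polynomial.differentiable (𝕜 := ℝ) (derivative r)).continuous
  have hA : Continuous fun z : ℝ => (z * (1 - z) * (derivative (derivative p)).eval z
      + (c - 2 * z) * (derivative p).eval z) * r.eval z :=
    (((continuous_id.mul (continuous_const.sub continuous_id)).mul hp'').add
      ((continuous_const.sub (continuous_const.mul continuous_id)).mul hp')).mul hr
  -- integrability of the two integrands
  have hi₁ : IntervalIntegrable (fun z => jacobiWeight c z * ((z * (1 - z)
      * (derivative (derivative p)).eval z + (c - 2 * z) * (derivative p).eval z) * r.eval z))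
      volume 0 1 :=
    intervalIntegrable_jacobiWeight_mul hc.le hc2 hA
  have hi₂ : IntervalIntegrable
      (fun z => jacobiFlux c z * (derivative p).eval z * (derivative r).eval z) volume 0 1 :=
    ((hPc.mul hp').mul hr').intervalIntegrable 0 1
  -- the derivative of `F = P p' r` inside `(0, 1)`
  have hderiv : ∀ z ∈ Ioo (0 : ℝ) 1,
      HasDerivAt (fun z => jacobiFlux c z * (derivative p).eval z * r.eval z)
        (jacobiWeight c z * ((z * (1 - z) * (derivative (derivative p)).eval z
            + (c - 2 * z) * (derivative p).eval z) * r.eval z)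
          + jacobiFlux c z * (derivative p).eval z * (derivative r).eval z) z := by
    intro z hz
    have h := ((hasDerivAt_jacobiFlux c hz).mul (Polynomial.hasDerivAt (derivative p) z)).mul
      (Polynomial.hasDerivAt r z)
    refine h.congr_deriv ?_
    simp only [Pi.mul_apply]
    rw [jacobiFlux_eq hc hc2 (Ioo_subset_Icc_self hz)]
    ring
  have hcont : ContinuousOn (fun z => jacobiFlux c z * (derivative p).eval z * r.eval z)
      (Icc 0 1) :=
    ((hPc.mul hp').mul hr).continuousOn
  have hftc := intervalIntegral.integral_eq_sub_of_hasDerivAt_of_le zero_le_one hcont hderiv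
    (hi₁.add hi₂)
  simp only [jacobiFlux_zero (by linarith : c ≠ 0), jacobiFlux_one (by linarith : c ≠ 2),
    zero_mul, sub_self] at hftc
  rw [intervalIntegral.integral_add hi₁ hi₂] at hftc
  linarith

/-- Green's identity applied to `y_n`: `-n(n+1) ∫₀¹ ρ y_n r = -∫₀¹ P y_n' r'`, i.e.
`∫₀¹ P y_n' r' = n(n+1) ∫₀¹ ρ y_n r` for every polynomial `r`. [folklore] -/
theorem integral_jacobiFlux_derivative_hypJacobi_mul (hc : 1 < c) (hc2 : c < 2) (n : ℕ)
    (r : ℝ[X]) :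
    ∫ z in (0 : ℝ)..1, jacobiFlux c z * (derivative (hypJacobi c n)).eval z * (derivative r).eval z
      = (n : ℝ) * (n + 1) *
        ∫ z in (0 : ℝ)..1, jacobiWeight c z * ((hypJacobi c n).eval z * r.eval z) := by
  have hck : ∀ k : ℕ, k < n → (k : ℝ) + c ≠ 0 := fun k _ => by positivity
  have hg := jacobi_green hc hc2 (hypJacobi c n) r
  have hode : ∀ z : ℝ, z * (1 - z) * (derivative (derivative (hypJacobi c n))).eval z
      + (c - 2 * z) * (derivative (hypJacobi c n)).eval z
      = -((n : ℝ) * (n + 1)) * (hypJacobi c n).eval z := fun z => by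
    linear_combination hypJacobi_ode_eval n hck z
  simp only [hode] at hg
  have : ∫ z in (0 : ℝ)..1, jacobiWeight c z * (-((n : ℝ) * (n + 1)) * (hypJacobi c n).eval z
      * r.eval z) = -((n : ℝ) * (n + 1)) *
        ∫ z in (0 : ℝ)..1, jacobiWeight c z * ((hypJacobi c n).eval z * r.eval z) := by
    rw [← intervalIntegral.integral_const_mul]
    exact intervalIntegral.integral_congr fun z _ => by ring
  linarith

/-- **Orthogonality** (AAR (2.5.14) for `α = c - 1`, `β = 1 - c`): for `n ≠ m` and `1 < c < 2`,
`∫₀¹ ρ(z) y_n(z) y_m(z) dz = 0`. Proof: by Green's identity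
`n(n+1) ∫ ρ y_n y_m = ∫ P y_n' y_m' = m(m+1) ∫ ρ y_n y_m`. [cite: AndrewsAskeyRoy1999, (2.5.14)] -/
theorem integral_jacobiWeight_hypJacobi_mul_hypJacobi (hc : 1 < c) (hc2 : c < 2) {n m : ℕ}
    (hnm : n ≠ m) :
    ∫ z in (0 : ℝ)..1, jacobiWeight c z * ((hypJacobi c n).eval z * (hypJacobi c m).eval z)
      = 0 := by
  have h1 := integral_jacobiFlux_derivative_hypJacobi_mul hc hc2 n (hypJacobi c m)
  have h2 := integral_jacobiFlux_derivative_hypJacobi_mul hc hc2 m (hypJacobi c n)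
  have hsymm : ∫ z in (0 : ℝ)..1, jacobiFlux c z * (derivative (hypJacobi c m)).eval z
      * (derivative (hypJacobi c n)).eval z = ∫ z in (0 : ℝ)..1, jacobiFlux c z
      * (derivative (hypJacobi c n)).eval z * (derivative (hypJacobi c m)).eval z :=
    intervalIntegral.integral_congr fun z _ => by ring
  have hsymm' : ∫ z in (0 : ℝ)..1, jacobiWeight c z * ((hypJacobi c m).eval z
      * (hypJacobi c n).eval z) = ∫ z in (0 : ℝ)..1, jacobiWeight c z * ((hypJacobi c n).eval z
      * (hypJacobi c m).eval z) :=
    intervalIntegral.integral_congr fun z _ => by ring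
  rw [hsymm, hsymm', h1] at h2
  set I := ∫ z in (0 : ℝ)..1, jacobiWeight c z * ((hypJacobi c n).eval z * (hypJacobi c m).eval z)
  have hne : (n : ℝ) * (n + 1) ≠ (m : ℝ) * (m + 1) := by
    intro h
    have h' : (n : ℝ) * (n + 1) = (m : ℝ) * (m + 1) := h
    have : n * (n + 1) = m * (m + 1) := by exact_mod_cast h'
    rcases lt_or_gt_of_ne hnm with hlt | hlt
    · have : n * (n + 1) < m * (m + 1) := Nat.mul_lt_mul'' hlt (by omega)
      omega
    · have : m * (m + 1) < n * (n + 1) := Nat.mul_lt_mul'' hlt (by omega)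
      omega
  have : ((n : ℝ) * (n + 1) - (m : ℝ) * (m + 1)) * I = 0 := by linarith
  rcases mul_eq_zero.1 this with h | h
  · exact absurd (sub_eq_zero.1 h) hne
  · exact h

/-- **Energy identity**: `∫₀¹ P (y_n')² = n(n+1) ∫₀¹ ρ y_n²` (`1 < c < 2`). [folklore] -/
theorem integral_jacobiFlux_derivative_sq (hc : 1 < c) (hc2 : c < 2) (n : ℕ) :
    ∫ z in (0 : ℝ)..1, jacobiFlux c z * ((derivative (hypJacobi c n)).eval z) ^ 2
      = (n : ℝ) * (n + 1) * ∫ z in (0 : ℝ)..1, jacobiWeight c z * ((hypJacobi c n).eval z) ^ 2 := by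
  have h := integral_jacobiFlux_derivative_hypJacobi_mul hc hc2 n (hypJacobi c n)
  rw [show (∫ z in (0 : ℝ)..1, jacobiFlux c z * ((derivative (hypJacobi c n)).eval z) ^ 2)
      = ∫ z in (0 : ℝ)..1, jacobiFlux c z * (derivative (hypJacobi c n)).eval z
        * (derivative (hypJacobi c n)).eval z from
      intervalIntegral.integral_congr fun z _ => by ring, h]
  congr 1
  exact intervalIntegral.integral_congr fun z _ => by ring

/-- **The norms are positive**: `0 < ∫₀¹ ρ y_n²` (`1 < c < 2`; `y_n(0) = 1` and `ρ > 0` inside).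
[folklore] -/
theorem integral_jacobiWeight_hypJacobi_sq_pos (hc : 1 < c) (hc2 : c < 2) (n : ℕ) :
    0 < ∫ z in (0 : ℝ)..1, jacobiWeight c z * ((hypJacobi c n).eval z) ^ 2 := by
  have hqc : Continuous fun z => (hypJacobi c n).eval z := continuous_hypJacobi_eval c n
  -- `y_n > 1/2` near `0`
  have hev : ∀ᶠ z in 𝓝 (0 : ℝ), (1 / 2 : ℝ) < (hypJacobi c n).eval z := by
    refine (hqc.continuousAt (x := 0)).eventually (lt_mem_nhds ?_)
    simp only [hypJacobi_eval_zero]; norm_num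
  obtain ⟨ε, hε, hball⟩ := Metric.eventually_nhds_iff.1 hev
  have hδ0 : 0 < min (ε / 2) (1 / 2) := lt_min (by linarith) (by norm_num)
  have hδ1 : min (ε / 2) (1 / 2) ≤ 1 := (min_le_right _ _).trans (by norm_num)
  have hδε : min (ε / 2) (1 / 2) < ε := (min_le_left _ _).trans_lt (by linarith)
  have hint : IntervalIntegrable (fun z => jacobiWeight c z * ((hypJacobi c n).eval z) ^ 2)
      volume 0 1 :=
    intervalIntegrable_jacobiWeight_mul hc.le hc2 (hqc.pow 2)
  have hI1 : IntervalIntegrable (fun z => jacobiWeight c z * ((hypJacobi c n).eval z) ^ 2)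
      volume 0 (min (ε / 2) (1 / 2)) := by
    refine hint.mono_set ?_
    rw [uIcc_of_le hδ0.le, uIcc_of_le zero_le_one]
    exact Icc_subset_Icc le_rfl hδ1
  have hI2 : IntervalIntegrable (fun z => jacobiWeight c z * ((hypJacobi c n).eval z) ^ 2)
      volume (min (ε / 2) (1 / 2)) 1 := by
    refine hint.mono_set ?_
    rw [uIcc_of_le hδ1, uIcc_of_le zero_le_one]
    exact Icc_subset_Icc hδ0.le le_rfl
  rw [← intervalIntegral.integral_add_adjacent_intervals hI1 hI2]
  have hpos : 0 < ∫ z in (0 : ℝ)..min (ε / 2) (1 / 2),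
      jacobiWeight c z * ((hypJacobi c n).eval z) ^ 2 := by
    refine intervalIntegral.intervalIntegral_pos_of_pos_on hI1 (fun z hz => ?_) hδ0
    have hqz : 1 / 2 < (hypJacobi c n).eval z := hball (by
      rw [Real.dist_eq, sub_zero, abs_of_pos hz.1]; exact hz.2.trans hδε)
    exact mul_pos (jacobiWeight_pos c ⟨hz.1, hz.2.trans_le hδ1⟩) (by positivity)
  have hnn : 0 ≤ ∫ z in min (ε / 2) (1 / 2)..1,
      jacobiWeight c z * ((hypJacobi c n).eval z) ^ 2 :=
    intervalIntegral.integral_nonneg hδ1 fun z hz =>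
      mul_nonneg (jacobiWeight_nonneg c ⟨hδ0.le.trans hz.1, hz.2⟩) (sq_nonneg _)
  linarith

end Green

/-! ### The degree of `y_n` is exactly `n` -/

/-- `a_k ≠ 0` for `k ≤ n` (`c ∉ {0, -1, …, -(n-1)}`). [folklore] -/
theorem hypJacobiCoeff_ne_zero {c : ℝ} {n : ℕ} (hc : ∀ k : ℕ, k < n → (k : ℝ) + c ≠ 0) {k : ℕ}
    (hk : k ≤ n) : hypJacobiCoeff c n k ≠ 0 := by
  induction k with
  | zero => simp
  | succ k ih =>
    rw [hypJacobiCoeff_succ]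
    refine mul_ne_zero (ih (Nat.le_of_succ_le hk)) (div_ne_zero ?_ ?_)
    · have h1 : (n : ℝ) - k ≠ 0 := by
        have : (k : ℝ) < n := by exact_mod_cast Nat.lt_of_succ_le hk
        linarith
      have h2 : (n : ℝ) + k + 1 ≠ 0 := by positivity
      exact neg_ne_zero.2 (mul_ne_zero h1 h2)
    · exact mul_ne_zero (by positivity) (hc k (Nat.lt_of_succ_le hk))

/-- **`deg y_n = n`** (`c ∉ {0, -1, …, -(n-1)}`). [folklore] -/
theorem natDegree_hypJacobi {c : ℝ} {n : ℕ} (hc : ∀ k : ℕ, k < n → (k : ℝ) + c ≠ 0) :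
    (hypJacobi c n).natDegree = n := by
  refine le_antisymm (natDegree_hypJacobi_le c n) ?_
  refine le_natDegree_of_ne_zero ?_
  rw [coeff_hypJacobi]
  exact hypJacobiCoeff_ne_zero hc le_rfl

/-- The leading coefficient of `y_n` is `a_n ≠ 0`. [folklore] -/
theorem leadingCoeff_hypJacobi {c : ℝ} {n : ℕ} (hc : ∀ k : ℕ, k < n → (k : ℝ) + c ≠ 0) :
    (hypJacobi c n).leadingCoeff = hypJacobiCoeff c n n := by
  rw [leadingCoeff, natDegree_hypJacobi hc, coeff_hypJacobi]

/-- `y_n ≠ 0`. [folklore] -/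
theorem hypJacobi_ne_zero (c : ℝ) (n : ℕ) : hypJacobi c n ≠ 0 := by
  intro h
  have := congrArg (eval 0) h
  rw [hypJacobi_eval_zero, eval_zero] at this
  exact one_ne_zero this

end Literature.Analysis.SpecialFunctions
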